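import Mathlib.LinearAlgebra.Matrix.Rank
import Mathlib.LinearAlgebra.Matrix.NonsingularInverse
import Summits.MatrixMultiplication.OmegaCensus.SmallFormats.RankOnePlaneCapEquality
import HarnessLib

/-!
# ω-census family (a): HEREDITARY restriction — dropping the terms whose Y-forms kill `k^m ⊗ E'`

Cell `pub-omega` (unit `pub-omega-tensor`, gen 22), topic `Summits/MatrixMultiplication/OmegaCensus`
(sub-folder `SmallFormats`). Framing (verbatim): lottery ticket; floor = certified bounds/negative
ranges. HONEST FRAMING: an elementary structural lemma (the Y-side analogue of the substitution step
`BilinComp.restrictDrop`), stated because the cell's exclusion engines USE it: tensor-g21 engine E2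
`SOUNDNESS-E2.md` §3 "hereditary caps `f_S ≥ n − qmax(S)`" (and tensor-g20 E1 §3) bound the F-type
configurations of a hypothetical `𝔽₃ ⟨2,2,7⟩ @ 23` scheme by restricting `Y` to the common subspace
`E' = ⋂_{θ ∈ S} E_θ` of the saturated rows `S`. Not a rank bound; nothing on `ω`.

**Lemma** (`restrictRows`). Let `β` compute `⟨c,m,n⟩` (`XY = ∑ f_i(X) g_i(Y) W_i`), let
`P ∈ k^{q×n}` have a right inverse `P Pʳ = 1_q` (its rows are a basis of a `q`-dimensional
`E' ⊂ kⁿ`), and let `J` be a set of indices whose Y-forms vanish on every `Y'P` (`Y' ∈ k^{m×q}`,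
i.e. on `k^m ⊗ E'`). Then the triples `(f_i, Y' ↦ g_i(Y'P), W_i Pʳ)`, `i ∉ J`, compute `⟨c,m,q⟩`:
`X Y' = ∑_{i ∉ J} f_i(X) g_i(Y'P) W_iPʳ` — the SAME X-forms on the surviving index set. Hence every
X-side cap of `⟨c,m,q⟩` (dual / `𝔽₉` / rank-one planes, point caps, `(S)`) applies to the X-marginal
of the terms outside `J` at length `r − |J|` (`card_restrictRows_index`).

**Use with the plane laws.** For a SATURATED row plane (`RankOnePlaneCapEquality.
card_vanishing_quant_eq`): the Y-forms of `R_θ` vanish EXACTLY on `k² ⊗ E_θ`; so for a set `S` of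
saturated rows, `J := ⋃_{θ∈S} R_θ` kills `k² ⊗ E'` with `E' := ⋂_{θ∈S} E_θ`, and the lemma yields a
`⟨c,2,dim E'⟩` computation by the other terms ⇒ `dim E' ≤ qmax(S)` ⇒
`dim ∑_{θ∈S} F_θ = n − dim E' ≥ n − qmax(S)` (`F_θ = E_θ^⊥`) — E2's hereditary cap
(`forall_rows_mem_of_vanishing`, the packaging used there). What is NOT here: the cap checker `qmax`
itself (a finite computation over `M₂(𝔽₃)`), the cap checker's tables. A basis matrix of `E'` always has a right inverse (`exists_mul_eq_one_of_linearIndependent_rows`).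
-/

namespace Summit.MatrixMultiplication.OmegaCensus.RankOnePlaneCapGeneral

open Module Matrix Literature.Computability.AlgebraicComplexity

variable {k : Type*} [Field k] {c m n q : ℕ} {ι : Type*} [Fintype ι]

/-- The Y-form `Y' ↦ g(Y' P)` of `⟨c,m,q⟩` obtained from a Y-form `g` of `⟨c,m,n⟩`. -/
def pullRows (g : Module.Dual k (Matrix (Fin m) (Fin n) k)) (P : Matrix (Fin q) (Fin n) k) :
    Module.Dual k (Matrix (Fin m) (Fin q) k) where
  toFun Y' := g (Y' * P)
  map_add' Y Y' := by rw [Matrix.add_mul, map_add]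
  map_smul' a Y := by rw [Matrix.smul_mul, map_smul, RingHom.id_apply]

/-- `pullRows g P Y' = g (Y' P)`. -/
@[simp] theorem pullRows_apply (g : Module.Dual k (Matrix (Fin m) (Fin n) k))
    (P : Matrix (Fin q) (Fin n) k) (Y' : Matrix (Fin m) (Fin q) k) :
    pullRows g P Y' = g (Y' * P) := rfl

/-- **Hereditary restriction** (rows of `Y` confined to the row space of `P`, terms `J` dropped):
if `P Pʳ = 1` and the Y-forms of `J` vanish on every `Y'P`, the triples
`(f_i, Y' ↦ g_i(Y'P), W_i Pʳ)`, `i ∉ J`, compute `⟨c,m,q⟩`. -/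
def restrictRows [DecidableEq ι] (β : BilinComp (mulBilin k c m n) ι)
    (P : Matrix (Fin q) (Fin n) k) (Pr : Matrix (Fin n) (Fin q) k) (hP : P * Pr = 1)
    (J : Finset ι) (hJ : ∀ i ∈ J, ∀ Y' : Matrix (Fin m) (Fin q) k, β.g i (Y' * P) = 0) :
    BilinComp (mulBilin k c m q) {i // i ∉ J} where
  f i := β.f i.1
  g i := pullRows (β.g i.1) P
  w i := β.w i.1 * Pr
  map_eq_sum X Y' := by
    classical
    have h := β.map_eq_sum X (Y' * P)
    rw [mulBilin_apply] at h
    have h1 : X * Y' = X * (Y' * P) * Pr := by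
      rw [Matrix.mul_assoc, Matrix.mul_assoc, hP, Matrix.mul_one]
    rw [mulBilin_apply, h1, h, Matrix.sum_mul]
    have h2 : ∑ i, ((β.f i X * β.g i (Y' * P)) • β.w i) * Pr
        = ∑ i ∈ Finset.univ.filter (fun i => i ∉ J),
            (β.f i X * β.g i (Y' * P)) • (β.w i * Pr) := by
      rw [Finset.sum_filter]
      refine Finset.sum_congr rfl fun i _ => ?_
      by_cases hi : i ∉ J
      · simp [hi, Matrix.smul_mul]
      · rw [not_not] at hi
        simp [hJ i hi Y']
    rw [h2]
    exact Finset.sum_subtype _ (by simp)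
      (fun i => (β.f i X * β.g i (Y' * P)) • (β.w i * Pr))

/-- The X-forms of `restrictRows` are the original ones. -/
@[simp] theorem restrictRows_f [DecidableEq ι] (β : BilinComp (mulBilin k c m n) ι)
    (P : Matrix (Fin q) (Fin n) k) (Pr : Matrix (Fin n) (Fin q) k) (hP : P * Pr = 1)
    (J : Finset ι) (hJ : ∀ i ∈ J, ∀ Y' : Matrix (Fin m) (Fin q) k, β.g i (Y' * P) = 0)
    (i : {i // i ∉ J}) : (restrictRows β P Pr hP J hJ).f i = β.f i.1 := rfl

/-- The Y-forms of `restrictRows`. -/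
@[simp] theorem restrictRows_g [DecidableEq ι] (β : BilinComp (mulBilin k c m n) ι)
    (P : Matrix (Fin q) (Fin n) k) (Pr : Matrix (Fin n) (Fin q) k) (hP : P * Pr = 1)
    (J : Finset ι) (hJ : ∀ i ∈ J, ∀ Y' : Matrix (Fin m) (Fin q) k, β.g i (Y' * P) = 0)
    (i : {i // i ∉ J}) (Y' : Matrix (Fin m) (Fin q) k) :
    (restrictRows β P Pr hP J hJ).g i Y' = β.g i.1 (Y' * P) := rfl

/-- The outputs of `restrictRows`. -/
@[simp] theorem restrictRows_w [DecidableEq ι] (β : BilinComp (mulBilin k c m n) ι)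
    (P : Matrix (Fin q) (Fin n) k) (Pr : Matrix (Fin n) (Fin q) k) (hP : P * Pr = 1)
    (J : Finset ι) (hJ : ∀ i ∈ J, ∀ Y' : Matrix (Fin m) (Fin q) k, β.g i (Y' * P) = 0)
    (i : {i // i ∉ J}) : (restrictRows β P Pr hP J hJ).w i = β.w i.1 * Pr := rfl

omit [Fintype ι] in
/-- The length of `restrictRows` is `r − |J|`. -/
theorem card_restrictRows_index [Fintype ι] [DecidableEq ι] (J : Finset ι) :
    Fintype.card {i // i ∉ J} = Fintype.card ι - J.card := by
  rw [Fintype.card_subtype_compl, Fintype.card_coe]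

/-- **Packaging for the plane laws.** If every row of every `Y'P` lies in `E` (e.g. the rows of `P`
lie in `E`) and the Y-forms of `J` vanish on all matrices with rows in `E` (the saturated-plane law's
`hzero`, direction `←`), then the hypothesis `hJ` of `restrictRows` holds. -/
theorem forall_rows_mem_of_vanishing (β : BilinComp (mulBilin k c m n) ι)
    (P : Matrix (Fin q) (Fin n) k) (E : Submodule k (Fin n → k)) (hPE : ∀ j, P j ∈ E)
    (J : Finset ι)
    (hzero : ∀ i ∈ J, ∀ Y : Matrix (Fin m) (Fin n) k, (∀ μ, Y μ ∈ E) → β.g i Y = 0) :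
    ∀ i ∈ J, ∀ Y' : Matrix (Fin m) (Fin q) k, β.g i (Y' * P) = 0 := by
  intro i hi Y'
  refine hzero i hi _ fun μ => ?_
  have hrow : (Y' * P) μ = ∑ j, Y' μ j • P j := by
    ext ν
    simp [Matrix.mul_apply, Finset.sum_apply, Pi.smul_apply, smul_eq_mul]
  rw [hrow]
  exact Submodule.sum_mem _ fun j _ => Submodule.smul_mem _ _ (hPE j)

/-- A matrix with linearly independent rows has a right inverse (so `restrictRows` applies to ANY
basis matrix `P` of a subspace `E' ⊂ kⁿ`). -/
theorem exists_mul_eq_one_of_linearIndependent_rows {P : Matrix (Fin q) (Fin n) k}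
    (hP : LinearIndependent k P.row) : ∃ Pr : Matrix (Fin n) (Fin q) k, P * Pr = 1 := by
  classical
  have hrank : finrank k (LinearMap.range P.mulVecLin) = finrank k (Fin q → k) := by
    rw [Module.finrank_fintype_fun_eq_card, ← LinearIndependent.rank_matrix hP]
    rfl
  have htop : LinearMap.range P.mulVecLin = ⊤ := Submodule.eq_top_of_finrank_eq hrank
  have hsurj : Function.Surjective P.mulVec := by
    intro y
    obtain ⟨x, hx⟩ := LinearMap.range_eq_top.1 htop y
    exact ⟨x, hx⟩
  exact Matrix.mulVec_surjective_iff_exists_right_inverse.1 hsurj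

end Summit.MatrixMultiplication.OmegaCensus.RankOnePlaneCapGeneral
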